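import Literature.MathematicalPhysics.QuantumFieldTheory.Balaban1983to89.StrongCouplingVarianceWindow

/-!
# `InfraRed.StrongCouplingDobrushinFloor` — the single-site Dobrushin door for `SU(2)` closes at `β_W = 2/9`
# (lineage IR-SC, certificate J-SC9; cell `pub-balaban`, tree target `Summits/QuantumFields/BalabanUV/InfraRed/`)

HONEST FRAMING (verbatim, binding): «observatory of the non-perturbative crossover; no mass-gap claim».
This is the STRONG-COUPLING front of the two-front crossover ledger (IR-3 v2) for `SU(2)`, `d = 4`, Wilson action,
`β_W = 4/g²` (tree bare coupling `β_W/2`, 't Hooft coupling `β_W/4`).  Elementary and kernel-checked; NOT a statement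
about Bałaban's renormalisation group, NOT the continuum, NOT Clay, NOT summit progress.  It proves NO new clustering:
it is a theorem ABOUT the door through which every owned strong-coupling number of the ledger has passed.

ABSOLUTE RULE.  No internally-minted statement may enter as a cited fact.  Every hypothesis is either kernel-proved in this
package or a verbatim quotation of a PUBLISHED theorem with page reference.  The manuscript(s) under audit are NOT citable for
their own disputed steps — they are the thing under adjudication; programme-internal (2001/route/tribunal) claims are never
citable.  In this file NOTHING printed is used as a hypothesis and nothing is cited: every statement is proved from Mathlib and
from the tree's definitions and theorems (`OneLinkKRModulus`, `OneLinkKRModulusSU2`, the `SU(2)` Haar moments of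
`StrongCouplingVarianceWindow`, the doors of `StrongCouplingTorusWindow` / `StrongCouplingDobrushinWindow` /
`StrongCouplingOpenWindow`), imported BY NAME and not modified.  The one `def … : Prop` below (`QuarterModulus`) is a TYPED
TARGET used only as an explicit hypothesis `(h : QuarterModulus)`; it is neither proved nor cited nor claimed.

WHAT THIS FILE PROVES.
* `oneLinkKRModulus_two_floor` — **the floor of the one-link Kantorovich–Rubinstein modulus of `SU(2)`**: if
  `OneLinkKRModulus 2 R K` holds on ANY ball of positive radius `R`, then `1 ≤ K`.  Witness: the pair `B = 0`,
  `B' = s·1` (`0 < s` small) and the `(1/√2)`-Lipschitz test function `x₀(g) = ½ Re tr g`; the tilted mean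
  `m(κ) = ∫ x₀ e^{κ x₀} dσ / ∫ e^{κ x₀} dσ` (`κ = 4s`) satisfies `m(κ) ≥ (κ/4 − κ²)/(1 + κ²/4)` from the Haar moments
  `E x₀ = 0`, `E x₀² = 1/4` and `|e^y − 1 − y| ≤ y²` (`|y| ≤ 1`), while the modulus gives `m(κ) ≤ K s`; `s → 0` forces `K ≥ 1`.
* `oneLinkKRModulusSU2_floor` — in the ledger's units (`OneLinkKRModulusSU2 βW K₂ := OneLinkKRModulus 2 (3βW/2) (4K₂)`):
  `0 < βW → OneLinkKRModulusSU2 βW K₂ → 1/4 ≤ K₂`.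
* `su2_dobrushinDoor_ceiling` — **the ceiling of the door**: the hypotheses of every `SU(2)` door of the lineage
  (`su2_strongCouplingFront_of_oneLinkKRModulus`, `su2_dlrMassGapAt_of_oneLinkKRModulus`,
  `su2_latticeMassGap_of_oneLinkKRModulusSU2`: `OneLinkKRModulusSU2 βW K₂ ∧ 18 βW K₂ < 1`) force `βW < 2/9`.
  Hence NO instance of the single-site Frobenius-weight Dobrushin scheme typed in this tree can own a strong-coupling
  front at or beyond `β_W = 2/9 = 0.2222…`, whatever modulus certificate is supplied (the owned column is `0.124`, J-SC8).
* `QuarterModulus` (`@[conjecture]`, TYPED TARGET, open) — the modulus with the floor constant up to the ceiling radius: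
  `∀ βW ∈ [0, 2/9], OneLinkKRModulusSU2 βW (1/4)`; and the conditional doors `su2_strongCouplingFront_of_quarterModulus`,
  `su2_dlrMassGapAt_of_quarterModulus`, `su2_latticeMassGap_of_quarterModulus`: under it the door opens at EVERY
  `βW < 2/9`, i.e. floor and ceiling meet.  (Off-kernel numerical evidence for the target — the computed one-link
  constant stays `≤ 1/4` for tilt strengths `κ ≤ 4/3` — is recorded, with its engines and its limits, in the lineage
  record `ir/FRONT-SC.md` (J-SC9); it is evidence, not a certificate, and nothing in this file depends on it.)

VERSIONS: v1 (IR-SC gen 6).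
-/

open MeasureTheory Real
open Literature.MathematicalPhysics.QuantumFieldTheory
open Literature.MathematicalPhysics.QuantumFieldTheory.Balaban1983to89
open Literature.MathematicalPhysics.QuantumLattice (su2Quat fundamentalRep fundamentalLatticeRep)
open Literature.MathematicalPhysics.QuantumFieldTheory.Balaban1983to89.StrongCouplingDobrushinWindow
open Literature.MathematicalPhysics.QuantumFieldTheory.Balaban1983to89.StrongCouplingTorusWindow
open Literature.MathematicalPhysics.QuantumFieldTheory.Balaban1983to89.StrongCouplingKernelWindow
open Literature.MathematicalPhysics.QuantumFieldTheory.Balaban1983to89.StrongCouplingOpenWindow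
open Literature.MathematicalPhysics.QuantumFieldTheory.Balaban1983to89.StrongCouplingVarianceWindow

namespace Summit.QuantumFields.BalabanUV.InfraRed.StrongCouplingDobrushinFloor

local notation "SU2" => Matrix.specialUnitaryGroup (Fin 2) ℂ
local notation "M₂" => Matrix (Fin 2) (Fin 2) ℂ
local notation "σ₂" => haarProbability (Matrix.specialUnitaryGroup (Fin 2) ℂ)

/-! ## Part A: the test function `x₀ = ½ Re tr` and the probe pair `B = 0`, `B' = s·1` -/

/-- `g ↦ x₀(g)` is continuous. [folklore] -/
private theorem continuous_x0 : Continuous fun g : SU2 => (su2Quat g).re := by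
  have h00 : Continuous fun g : SU2 => (g : M₂) 0 0 :=
    (continuous_apply_apply 0 0).comp continuous_subtype_val
  exact Complex.continuous_re.comp h00

/-- Continuous functions of `x₀` are Haar integrable. [folklore] -/
private theorem integrable_x0_fun {Φ : ℝ → ℝ} (hΦ : Continuous Φ) :
    Integrable (fun g : SU2 => Φ ((su2Quat g).re)) σ₂ :=
  (hΦ.comp continuous_x0).integrable_of_hasCompactSupport (HasCompactSupport.of_compactSpace _)

/-- `|x₀| ≤ 1`. [folklore] -/
private theorem abs_x0_le (g : SU2) : |(su2Quat g).re| ≤ 1 := by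
  have h := sq_sum_su2Quat g
  rw [abs_le]
  constructor <;> nlinarith [sq_nonneg (su2Quat g).imI, sq_nonneg (su2Quat g).imJ, sq_nonneg (su2Quat g).imK,
    sq_nonneg ((su2Quat g).re + 1), sq_nonneg ((su2Quat g).re - 1)]

/-- `E x₀ = 0`. [folklore] -/
private theorem integral_x0 : ∫ g, (su2Quat g).re ∂σ₂ = 0 := by
  simpa using integral_re_pow_odd 0

/-- `2 x₀(g) = Re tr g` on `SU(2)`. [folklore] -/
private theorem two_x0_eq_re_trace (g : SU2) : 2 * (su2Quat g).re = ((g : M₂)).trace.re := by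
  rw [Matrix.trace_fin_two, Complex.add_re, Literature.MathematicalPhysics.QuantumLattice.su2_apply_11 g, Complex.conj_re]
  simp only [su2Quat]
  ring

/-- `x₀` is `(√2/2)`-Lipschitz for the Frobenius distance. [folklore] -/
private theorem abs_x0_sub_le (a b : SU2) :
    |(su2Quat a).re - (su2Quat b).re| ≤ Real.sqrt 2 / 2 * suFrobDist a b := by
  have h := abs_re_trace_su2_mul_le_frob (1 : SU2) ((a : M₂) - (b : M₂))
  simp only [OneMemClass.coe_one, Matrix.one_mul, Matrix.trace_sub, Complex.sub_re, ← two_x0_eq_re_trace] at h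
  have h2 : |2 * (su2Quat a).re - 2 * (su2Quat b).re| = 2 * |(su2Quat a).re - (su2Quat b).re| := by
    rw [← mul_sub, abs_mul, abs_two]
  rw [h2] at h
  unfold suFrobDist
  linarith

/-- `Re tr(g · s1) = 2 s x₀(g)`. [folklore] -/
private theorem re_trace_mul_smul_one (g : SU2) (s : ℝ) :
    ((g : M₂) * ((s : ℂ) • (1 : M₂))).trace.re = 2 * s * (su2Quat g).re := by
  rw [Matrix.mul_smul, Matrix.mul_one, Matrix.trace_smul, smul_eq_mul, Complex.mul_re, Complex.ofReal_re,
    Complex.ofReal_im, zero_mul, sub_zero, ← two_x0_eq_re_trace]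
  ring

/-- `‖0‖_op = 0`. [folklore] -/
private theorem matrixOpNorm_zero₂ : matrixOpNorm (0 : M₂) = 0 := by
  have h := matrixOpNorm_smul (0 : ℂ) (1 : M₂)
  rwa [zero_smul, norm_zero, zero_mul] at h

/-- `‖s·1‖_op = s` for `s ≥ 0`. [folklore] -/
private theorem matrixOpNorm_smul_one {s : ℝ} (hs : 0 ≤ s) : matrixOpNorm ((s : ℂ) • (1 : M₂)) = s := by
  rw [matrixOpNorm_smul, matrixOpNorm_of_mem_unitaryGroup (Submonoid.one_mem _), mul_one, Complex.norm_real,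
    Real.norm_of_nonneg hs]

/-- `‖0 − s·1‖_F = √2 s` for `s ≥ 0`. [folklore] -/
private theorem frobNorm_zero_sub_smul_one {s : ℝ} (hs : 0 ≤ s) :
    frobNorm ((0 : M₂) - (s : ℂ) • (1 : M₂)) = Real.sqrt 2 * s := by
  rw [frobNorm_sub_comm, sub_zero, frobNorm_smul, Complex.norm_real, Real.norm_of_nonneg hs]
  have h1 : frobNorm (1 : M₂) = Real.sqrt 2 := by
    simpa using frobNorm_su (N := 2) 1
  rw [h1, mul_comm]

/-! ## Part B: the tilted mean `m(κ) ≥ (κ/4 − κ²)/(1 + κ²/4)` for `0 ≤ κ ≤ 1/4` -/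

/-- Pointwise: `x + κ x² − κ² ≤ x e^{κ x}` for `|x| ≤ 1`, `0 ≤ κ ≤ 1`. [folklore] -/
private theorem lower_pointwise {κ x : ℝ} (hκ0 : 0 ≤ κ) (hκ1 : κ ≤ 1) (hx : |x| ≤ 1) :
    x + κ * x ^ 2 - κ ^ 2 ≤ exp (κ * x) * x := by
  have hy : |κ * x| ≤ 1 := by
    rw [abs_mul, abs_of_nonneg hκ0]
    calc κ * |x| ≤ 1 * 1 := mul_le_mul hκ1 hx (abs_nonneg _) zero_le_one
      _ = 1 := one_mul _
  have hr := Real.abs_exp_sub_one_sub_id_le hy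
  have hx2 : x ^ 2 ≤ 1 := by
    have := abs_le.1 hx
    nlinarith
  have h1 : |x * (exp (κ * x) - 1 - κ * x)| ≤ κ ^ 2 := by
    rw [abs_mul]
    calc |x| * |exp (κ * x) - 1 - κ * x| ≤ 1 * (κ * x) ^ 2 := mul_le_mul hx hr (abs_nonneg _) zero_le_one
      _ = κ ^ 2 * x ^ 2 := by ring
      _ ≤ κ ^ 2 * 1 := mul_le_mul_of_nonneg_left hx2 (sq_nonneg κ)
      _ = κ ^ 2 := mul_one _
  have h2 := neg_abs_le (x * (exp (κ * x) - 1 - κ * x))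
  have h3 : exp (κ * x) * x = x + κ * x ^ 2 + x * (exp (κ * x) - 1 - κ * x) := by ring
  rw [h3]
  linarith

/-- Pointwise: `e^{κ x} ≤ 1 + κ x + κ² x²` for `|x| ≤ 1`, `0 ≤ κ ≤ 1`. [folklore] -/
private theorem upper_pointwise {κ x : ℝ} (hκ0 : 0 ≤ κ) (hκ1 : κ ≤ 1) (hx : |x| ≤ 1) :
    exp (κ * x) ≤ 1 + κ * x + κ ^ 2 * x ^ 2 := by
  have hy : |κ * x| ≤ 1 := by
    rw [abs_mul, abs_of_nonneg hκ0]
    calc κ * |x| ≤ 1 * 1 := mul_le_mul hκ1 hx (abs_nonneg _) zero_le_one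
      _ = 1 := one_mul _
  have hr := (abs_le.1 (Real.abs_exp_sub_one_sub_id_le hy)).2
  nlinarith [hr]

/-- **The tilted mean from the Haar moments.**  For `0 ≤ κ ≤ 1/4`,
`(κ/4 − κ²)/(1 + κ²/4) ≤ ∫ x₀ d(σ.tilted (κ x₀))`. [folklore] -/
private theorem tilted_mean_lower {κ : ℝ} (hκ0 : 0 ≤ κ) (hκ1 : κ ≤ 1 / 4) :
    (κ / 4 - κ ^ 2) / (1 + κ ^ 2 / 4) ≤ ∫ g, (su2Quat g).re ∂((σ₂).tilted fun g => κ * (su2Quat g).re) := by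
  have hκ1' : κ ≤ 1 := by linarith
  rw [integral_tilted]
  simp only [smul_eq_mul]
  set Z : ℝ := ∫ g, exp (κ * (su2Quat g).re) ∂σ₂ with hZ
  -- integrability of everything in sight
  have iexp : Integrable (fun g : SU2 => exp (κ * (su2Quat g).re)) σ₂ :=
    integrable_x0_fun (Φ := fun x => exp (κ * x)) (by fun_prop)
  have iexpx : Integrable (fun g : SU2 => exp (κ * (su2Quat g).re) * (su2Quat g).re) σ₂ :=
    integrable_x0_fun (Φ := fun x => exp (κ * x) * x) (by fun_prop)
  have ilow : Integrable (fun g : SU2 => (su2Quat g).re + κ * (su2Quat g).re ^ 2 - κ ^ 2) σ₂ :=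
    integrable_x0_fun (Φ := fun x => x + κ * x ^ 2 - κ ^ 2) (by fun_prop)
  have iup : Integrable (fun g : SU2 => 1 + κ * (su2Quat g).re + κ ^ 2 * (su2Quat g).re ^ 2) σ₂ :=
    integrable_x0_fun (Φ := fun x => 1 + κ * x + κ ^ 2 * x ^ 2) (by fun_prop)
  have ix : Integrable (fun g : SU2 => (su2Quat g).re) σ₂ := integrable_x0_fun (Φ := fun x => x) continuous_id
  have ix2 : Integrable (fun g : SU2 => (su2Quat g).re ^ 2) σ₂ :=
    integrable_x0_fun (Φ := fun x => x ^ 2) (continuous_id.pow 2)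
  -- `Z > 0` and `Z ≤ 1 + κ²/4`
  have hZpos : 0 < Z := integral_exp_pos iexp
  have hZle : Z ≤ 1 + κ ^ 2 / 4 := by
    have hup : ∫ g, (1 + κ * (su2Quat g).re + κ ^ 2 * (su2Quat g).re ^ 2) ∂σ₂ = 1 + κ ^ 2 / 4 := by
      rw [integral_add, integral_add, integral_const_mul, integral_const_mul, integral_x0, integral_re_sq]
      · simp; ring
      · exact integrable_const _
      · exact ix.const_mul κ
      · exact (integrable_const _).add (ix.const_mul κ)
      · exact ix2.const_mul _
    rw [hZ, ← hup]
    exact integral_mono iexp iup fun g => upper_pointwise hκ0 hκ1' (abs_x0_le g)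
  -- the numerator
  have hN : κ / 4 - κ ^ 2 ≤ ∫ g, exp (κ * (su2Quat g).re) * (su2Quat g).re ∂σ₂ := by
    have hlow : ∫ g, ((su2Quat g).re + κ * (su2Quat g).re ^ 2 - κ ^ 2) ∂σ₂ = κ / 4 - κ ^ 2 := by
      rw [integral_sub, integral_add, integral_const_mul, integral_x0, integral_re_sq]
      · simp; ring
      · exact ix
      · exact ix2.const_mul κ
      · exact ix.add (ix2.const_mul κ)
      · exact integrable_const _
    rw [← hlow]
    exact integral_mono ilow iexpx fun g => lower_pointwise hκ0 hκ1' (abs_x0_le g)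
  have hNnn : 0 ≤ κ / 4 - κ ^ 2 := by nlinarith
  have hrw : ∫ g, exp (κ * (su2Quat g).re) / Z * (su2Quat g).re ∂σ₂ =
      (∫ g, exp (κ * (su2Quat g).re) * (su2Quat g).re ∂σ₂) / Z := by
    rw [← integral_div]
    refine integral_congr_ae (Filter.Eventually.of_forall fun g => ?_)
    ring
  rw [hrw]
  calc (κ / 4 - κ ^ 2) / (1 + κ ^ 2 / 4) ≤ (κ / 4 - κ ^ 2) / Z := div_le_div_of_nonneg_left hNnn hZpos hZle
    _ ≤ (∫ g, exp (κ * (su2Quat g).re) * (su2Quat g).re ∂σ₂) / Z := div_le_div_of_nonneg_right hN hZpos.le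

/-! ## Part C: the floor theorem and the ceiling of the door -/

/-- **Floor of the one-link Kantorovich–Rubinstein modulus of `SU(2)`.**  If `OneLinkKRModulus 2 R K` holds on a ball
of positive radius `R`, then `K ≥ 1`: the pair `B = 0`, `B' = s·1` and the test function `x₀ = ½ Re tr` exhibit
`|∫ x₀ dν_0 − ∫ x₀ dν_{s1}| = m(4s) ≥ (s − 16 s²)/(1 + 4 s²)` against the modulus bound `K · (√2/2) · √2 s = K s`.
[folklore] -/
theorem oneLinkKRModulus_two_floor {R K : ℝ} (hR : 0 < R) (hmod : OneLinkKRModulus 2 R K) : 1 ≤ K := by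
  by_contra hK'
  have hK : K < 1 := not_le.1 hK'
  set s : ℝ := min (min R (1 / 16)) ((1 - K) / 17) with hs_def
  have hsR : s ≤ R := (min_le_left _ _).trans (min_le_left _ _)
  have hs16 : s ≤ 1 / 16 := (min_le_left _ _).trans (min_le_right _ _)
  have hs17 : s ≤ (1 - K) / 17 := min_le_right _ _
  have hs0 : 0 < s := lt_min (lt_min hR (by norm_num)) (by linarith)
  have key := hmod 0 ((s : ℂ) • (1 : M₂)) (by rw [matrixOpNorm_zero₂]; exact hR.le)
    (by rw [matrixOpNorm_smul_one hs0.le]; exact hsR) (fun g => (su2Quat g).re) (Real.sqrt 2 / 2)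
    continuous_x0.measurable ⟨1, abs_x0_le⟩ (by positivity) abs_x0_sub_le
  rw [frobNorm_zero_sub_smul_one hs0.le] at key
  simp only [mul_zero, Matrix.trace_zero, Complex.zero_re, tilted_const, re_trace_mul_smul_one, Nat.cast_ofNat,
    integral_x0, zero_sub, abs_neg] at key
  have ht : (fun g : SU2 => (2 : ℝ) * (2 * s * (su2Quat g).re)) = fun g => (4 * s) * (su2Quat g).re := by
    funext g; ring
  rw [ht] at key
  have hm := tilted_mean_lower (κ := 4 * s) (by positivity) (by linarith)
  have hKs : K * (Real.sqrt 2 / 2) * (Real.sqrt 2 * s) = K * s := by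
    have h2 : Real.sqrt 2 * Real.sqrt 2 = 2 := Real.mul_self_sqrt (by norm_num)
    calc K * (Real.sqrt 2 / 2) * (Real.sqrt 2 * s) = K * s * (Real.sqrt 2 * Real.sqrt 2) / 2 := by ring
      _ = K * s := by rw [h2]; ring
  rw [hKs] at key
  have hfrac : (4 * s / 4 - (4 * s) ^ 2) / (1 + (4 * s) ^ 2 / 4) = (s - 16 * s ^ 2) / (1 + 4 * s ^ 2) := by
    ring
  rw [hfrac] at hm
  have h : (s - 16 * s ^ 2) / (1 + 4 * s ^ 2) ≤ K * s := hm.trans ((le_abs_self _).trans key)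
  rw [div_le_iff₀ (by positivity)] at h
  have h17 : 17 * s ≤ 1 - K := by
    have := (le_div_iff₀ (by norm_num : (0 : ℝ) < 17)).1 hs17
    linarith
  have p1 : K * s ≤ s - 17 * s ^ 2 := by nlinarith
  have p2 : K * s ^ 3 ≤ s ^ 3 := by nlinarith [pow_pos hs0 3]
  have p3 : s ^ 3 ≤ s ^ 2 / 16 := by
    calc s ^ 3 = s * s ^ 2 := by ring
      _ ≤ 1 / 16 * s ^ 2 := mul_le_mul_of_nonneg_right hs16 (sq_nonneg s)
      _ = s ^ 2 / 16 := by ring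
  have h' : s - 16 * s ^ 2 ≤ K * s + 4 * (K * s ^ 3) := by
    have : K * s * (1 + 4 * s ^ 2) = K * s + 4 * (K * s ^ 3) := by ring
    linarith
  nlinarith [pow_pos hs0 2]

/-- **Floor in the ledger's units.**  `OneLinkKRModulusSU2 βW K₂` at `βW > 0` forces `K₂ ≥ 1/4`. [folklore] -/
theorem oneLinkKRModulusSU2_floor {βW K₂ : ℝ} (hβ : 0 < βW) (hmod : OneLinkKRModulusSU2 βW K₂) : 1 / 4 ≤ K₂ := by
  have h := oneLinkKRModulus_two_floor (R := 3 * βW / 2) (K := 4 * K₂) (by positivity) hmod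
  linarith

/-- **Ceiling of the single-site Dobrushin door for `SU(2)`, `d = 4`.**  The hypotheses of the lineage's doors
(`OneLinkKRModulusSU2 βW K₂`, `18 βW K₂ < 1`) force `βW < 2/9`: no modulus certificate whatsoever can push an owned
strong-coupling front of this scheme to `β_W ≥ 2/9 = 0.2222…`. [folklore] -/
theorem su2_dobrushinDoor_ceiling {βW K₂ : ℝ} (hβ : 0 < βW) (hmod : OneLinkKRModulusSU2 βW K₂)
    (hsmall : 18 * βW * K₂ < 1) : βW < 2 / 9 := by
  have h := oneLinkKRModulusSU2_floor hβ hmod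
  nlinarith

/-- The ceiling, contrapositive form: at `βW ≥ 2/9` the door's smallness condition fails for every admissible `K₂`.
[folklore] -/
theorem su2_dobrushinDoor_closed {βW K₂ : ℝ} (hβ : 2 / 9 ≤ βW) (hmod : OneLinkKRModulusSU2 βW K₂) :
    1 ≤ 18 * βW * K₂ := by
  have h := oneLinkKRModulusSU2_floor (by linarith) hmod
  nlinarith

/-! ## Part D: the typed target `QuarterModulus` — floor meets ceiling -/

/-- HYPOTHESIS SHAPE — **TYPED TARGET (open; neither proved nor cited, never asserted).**  The one-link modulus of
`SU(2)` with the floor constant `K₂ = 1/4` on the whole sub-ceiling range `0 ≤ βW ≤ 2/9` (radius `R = 3βW/2 ≤ 1/3`,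
tilt strength `κ ≤ 4/3`).  Used below ONLY as an explicit hypothesis `(h : QuarterModulus)`; tagged `@[conjecture]` = an open node of our
theories (NOT literature, NOT a fact). [folklore] -/
@[conjecture]
def QuarterModulus : Prop :=
  ∀ βW : ℝ, 0 ≤ βW → βW ≤ 2 / 9 → OneLinkKRModulusSU2 βW (1 / 4)

/-- Under `QuarterModulus` the SC-b door opens at every `β₀W < 2/9` (torus clustering uniform in the volume, via the tree's
`su2_strongCouplingFront_of_oneLinkKRModulus`). [folklore] -/
theorem su2_strongCouplingFront_of_quarterModulus (h : QuarterModulus) {β₀W : ℝ} (h0 : 0 ≤ β₀W) (hlt : β₀W < 2 / 9) :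
    CrossoverLedger.StrongCouplingFront (fundamentalLatticeRep 2) (β₀W / 2) :=
  su2_strongCouplingFront_of_oneLinkKRModulus (by norm_num) (h β₀W h0 hlt.le) (by nlinarith)

/-- Under `QuarterModulus` the SC-a door opens at every `βW < 2/9` (DLR uniqueness and clustering at 't Hooft coupling
`βW/4`, via the tree's `su2_dlrMassGapAt_of_oneLinkKRModulus`). [folklore] -/
theorem su2_dlrMassGapAt_of_quarterModulus (h : QuarterModulus) {βW : ℝ} (h0 : 0 ≤ βW) (hlt : βW < 2 / 9) :
    DLRMassGapAt 4 2 (βW / 4) :=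
  su2_dlrMassGapAt_of_oneLinkKRModulus h0 (by norm_num) (h βW h0 hlt.le) (by nlinarith)

/-- Under `QuarterModulus` the SC-c door opens at every `βW < 2/9` (CMP2020 lattice mass gap with rate
`krRate (9 βW / 2)`, via the tree's `su2_latticeMassGap_of_oneLinkKRModulusSU2`). [folklore] -/
theorem su2_latticeMassGap_of_quarterModulus (h : QuarterModulus) {βW : ℝ} (h0 : 0 ≤ βW) (hlt : βW < 2 / 9) :
    CrossoverLedger.LatticeMassGap (fundamentalRep (Fin 2)) (βW / 2) (krRate (18 * βW * (1 / 4))) :=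
  su2_latticeMassGap_of_oneLinkKRModulusSU2 h0 (by norm_num) (h βW h0 hlt.le) (by nlinarith)

/-- **Floor meets ceiling.**  Under `QuarterModulus`, `βW ↦ (the SC-b door opens at βW)` holds exactly on `[0, 2/9)`
among `βW ≥ 0`: it opens below `2/9` (previous theorems) and the door's hypotheses are unsatisfiable at and above `2/9`
(`su2_dobrushinDoor_closed`). [folklore] -/
theorem su2_door_iff_of_quarterModulus (h : QuarterModulus) {βW : ℝ} (h0 : 0 ≤ βW) :
    (∃ K₂ : ℝ, 0 ≤ K₂ ∧ OneLinkKRModulusSU2 βW K₂ ∧ 18 * βW * K₂ < 1) ↔ βW < 2 / 9 := by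
  constructor
  · rintro ⟨K₂, -, hmod, hsmall⟩
    rcases eq_or_lt_of_le h0 with h00 | hpos
    · rw [← h00]; norm_num
    · exact su2_dobrushinDoor_ceiling hpos hmod hsmall
  · intro hlt
    exact ⟨1 / 4, by norm_num, h βW h0 hlt.le, by nlinarith⟩

end Summit.QuantumFields.BalabanUV.InfraRed.StrongCouplingDobrushinFloor
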